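import Mathlib
import Summits.FinalStateConjecture.Statement

/-!
# Crux `GenericCensorshipCollarMargin` (stmt-FinalStateConjecture-10809) — ideator 4, round 2
# Sketch for the crux idea `flat-backward-dial`

Three checkable pieces, over existing declarations only:

1. `BlueshiftBudget` — the lever in one ODE.  Along a horizon generator the first transversal
   derivative `X` of a field obeys the red-shift transport law `dX/dv = -κ X + S` (κ = surface
   gravity, `S` = tangential data).  Solving BACKWARDS from advanced time `V` to `v₀` amplifies by
   the blue-shift factor `exp (κ (V - v₀))`; the deviation from the `κ = 0` (extremal) backward
   solution is at most `(exp (κ (V - v₀)) - 1) · (|X V| + ∫ |S|)`.  Hence data TRUNCATED at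
   `V = θ / κ` cost a uniform factor `e^θ`, and `θ → 0` recovers the extremal answer: the extremal
   end of the Kerr family is the blue-shift-free end of the backward problem
   (Dafermos–Holzegel–Rodnianski arXiv:1306.5364 §1.1.5, §1.3.1; Angelopoulos–Aretakis–Gajic
   arXiv:1910.07975 Thm 1/4).
2. `EscapesAlongTameCurve` / `isTameChristodoulouGeneric_iff` — the Statement's TAME genericity
   (`InitialDataSet.IsTameChristodoulouGeneric`, the notion the restated crux must use: the filed
   decl's topology-free `IsChristodoulouGeneric` no longer feeds `FinalStateConjecture`) unfolded
   as "one escaping tame, immersed, injective curve through every exceptional datum".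
3. `tameGeneric_and_of_dial` — the ASSEMBLY SHAPE of the line (pure logic, proved): censorship
   curves landing in a backward-representable class `𝒮` + flat post-composition of the dial on
   `𝒮`-valued curves + rates (censored margin-failures are representable) + the dial at representable
   exceptional data ⟹ tame genericity of (censorship ∧ margin).  Each hypothesis is a named stub of
   the future line; nothing analytic is hidden in the proof.
-/

noncomputable section

set_option linter.dupNamespace false

open Set Filter Topology MeasureTheory intervalIntegral
open scoped Manifold ContDiff Topology

namespace Summit.FinalStateConjecture.FinalStateConjecture.Cruxes.GenericCensorshipCollarMargin.FlatBackwardDial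

/-! ## 1. The backward blue-shift budget (first lemma of the line; elementary real analysis) -/

/-- **Blue-shift budget.** For `κ ≥ 0`, a solution `X` of the red-shift transport law
`X' = -κ X + S` on `[v₀, V]` satisfies, when read BACKWARDS from `V`,
`|X v₀ - (X V - ∫_{v₀}^{V} S)| ≤ (exp (κ (V - v₀)) - 1) (|X V| + ∫_{v₀}^{V} |S|)`:
the deviation from the extremal (`κ = 0`) backward solution is controlled by the blue-shift factor
minus one.  With `κ (V - v₀) ≤ θ` the cost of solving backwards from truncated data is `e^θ`,
uniformly as `κ → 0`. [cite: arXiv13065364, §1.1.5] -/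
def BlueshiftBudget : Prop :=
  ∀ (κ v₀ V : ℝ) (S X : ℝ → ℝ), 0 ≤ κ → v₀ ≤ V → ContinuousOn S (Icc v₀ V) →
    ContinuousOn X (Icc v₀ V) →
    (∀ v ∈ Ioo v₀ V, HasDerivAt X (-κ * X v + S v) v) →
    |X v₀ - (X V - ∫ s in v₀..V, S s)| ≤
      (Real.exp (κ * (V - v₀)) - 1) * (|X V| + ∫ s in v₀..V, |S s|)

/-- Sanity instance of the budget: at the extremal end `κ = 0` the backward solution from `V` IS
`X V - ∫ S` (fundamental theorem of calculus), so the deviation vanishes. -/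
theorem blueshiftBudget_extremal (v₀ V : ℝ) (S X : ℝ → ℝ) (hle : v₀ ≤ V)
    (hS : ContinuousOn S (Icc v₀ V)) (hX : ContinuousOn X (Icc v₀ V))
    (hODE : ∀ v ∈ Ioo v₀ V, HasDerivAt X (-(0 : ℝ) * X v + S v) v) :
    X v₀ - (X V - ∫ s in v₀..V, S s) = 0 := by
  have hderiv : ∀ v ∈ Ioo v₀ V, HasDerivAt X (S v) v := fun v hv =>
    (hODE v hv).congr_deriv (by ring)
  have hint : IntervalIntegrable S volume v₀ V := hS.intervalIntegrable_of_Icc hle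
  have hftc := integral_eq_sub_of_hasDerivAt_of_le hle hX hderiv hint
  linarith

/-- **The blue-shift budget holds** (integrating factor `exp (κ (v - v₀))`, fundamental theorem of
calculus, monotonicity of `exp`). -/
theorem blueshiftBudget_holds : BlueshiftBudget := by
  intro κ v₀ V S X hκ hle hS hX hODE
  -- the integrating factor `E w = exp (κ (w - v₀))`
  have hEderiv : ∀ v, HasDerivAt (fun w => Real.exp (κ * (w - v₀)))
      (Real.exp (κ * (v - v₀)) * κ) v := by
    intro v
    have h1 : HasDerivAt (fun w => κ * (w - v₀)) κ v := by
      simpa using ((hasDerivAt_id v).sub_const v₀).const_mul κ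
    exact h1.exp
  have hEcont : Continuous fun w => Real.exp (κ * (w - v₀)) := by fun_prop
  -- `Y = E · X` solves `Y' = E · S`
  have hYderiv : ∀ v ∈ Ioo v₀ V,
      HasDerivAt (fun w => Real.exp (κ * (w - v₀)) * X w) (Real.exp (κ * (v - v₀)) * S v) v := by
    intro v hv
    exact ((hEderiv v).mul (hODE v hv)).congr_deriv (by ring)
  have hYcont : ContinuousOn (fun w => Real.exp (κ * (w - v₀)) * X w) (Icc v₀ V) :=
    hEcont.continuousOn.mul hX
  have hESint : IntervalIntegrable (fun w => Real.exp (κ * (w - v₀)) * S w) volume v₀ V :=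
    (hEcont.continuousOn.mul hS).intervalIntegrable_of_Icc hle
  have hftc := integral_eq_sub_of_hasDerivAt_of_le hle hYcont hYderiv hESint
  -- hftc : ∫ E·S = E V · X V - E v₀ · X v₀, and E v₀ = 1
  have hE0 : Real.exp (κ * (v₀ - v₀)) = 1 := by simp
  rw [hE0, one_mul] at hftc
  have hSint : IntervalIntegrable S volume v₀ V := hS.intervalIntegrable_of_Icc hle
  -- rewrite the deviation from the `κ = 0` backward solution
  have key : X v₀ - (X V - ∫ s in v₀..V, S s) =
      (Real.exp (κ * (V - v₀)) - 1) * X V -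
        ∫ s in v₀..V, (Real.exp (κ * (s - v₀)) - 1) * S s := by
    have hsub : ∫ s in v₀..V, (Real.exp (κ * (s - v₀)) - 1) * S s =
        (∫ s in v₀..V, Real.exp (κ * (s - v₀)) * S s) - ∫ s in v₀..V, S s := by
      rw [← intervalIntegral.integral_sub hESint hSint]
      congr 1
      funext s
      ring
    rw [hsub, hftc]
    ring
  rw [key]
  have hexp1 : 0 ≤ Real.exp (κ * (V - v₀)) - 1 :=
    sub_nonneg.2 (Real.one_le_exp (mul_nonneg hκ (sub_nonneg.2 hle)))
  -- pointwise bound on the integrand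
  have hbound : ∀ s ∈ Icc v₀ V,
      |(Real.exp (κ * (s - v₀)) - 1) * S s| ≤ (Real.exp (κ * (V - v₀)) - 1) * |S s| := by
    intro s hs
    rw [abs_mul]
    have h0 : 0 ≤ Real.exp (κ * (s - v₀)) - 1 :=
      sub_nonneg.2 (Real.one_le_exp (mul_nonneg hκ (by linarith [hs.1])))
    have h1 : Real.exp (κ * (s - v₀)) - 1 ≤ Real.exp (κ * (V - v₀)) - 1 := by
      have : κ * (s - v₀) ≤ κ * (V - v₀) := mul_le_mul_of_nonneg_left (by linarith [hs.2]) hκ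
      linarith [Real.exp_le_exp.2 this]
    rw [abs_of_nonneg h0]
    exact mul_le_mul_of_nonneg_right h1 (abs_nonneg _)
  have hint1 : IntervalIntegrable (fun s => |(Real.exp (κ * (s - v₀)) - 1) * S s|) volume v₀ V :=
    (((hEcont.continuousOn.sub continuousOn_const).mul hS).abs).intervalIntegrable_of_Icc hle
  have hint2 : IntervalIntegrable (fun s => (Real.exp (κ * (V - v₀)) - 1) * |S s|) volume v₀ V :=
    (continuousOn_const.mul hS.abs).intervalIntegrable_of_Icc hle
  calc |(Real.exp (κ * (V - v₀)) - 1) * X V - ∫ s in v₀..V, (Real.exp (κ * (s - v₀)) - 1) * S s|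
      ≤ |(Real.exp (κ * (V - v₀)) - 1) * X V| +
          |∫ s in v₀..V, (Real.exp (κ * (s - v₀)) - 1) * S s| := abs_sub _ _
    _ ≤ (Real.exp (κ * (V - v₀)) - 1) * |X V| +
          ∫ s in v₀..V, (Real.exp (κ * (V - v₀)) - 1) * |S s| := by
        apply add_le_add
        · rw [abs_mul, abs_of_nonneg hexp1]
        · calc |∫ s in v₀..V, (Real.exp (κ * (s - v₀)) - 1) * S s|
              ≤ ∫ s in v₀..V, |(Real.exp (κ * (s - v₀)) - 1) * S s| :=
                intervalIntegral.abs_integral_le_integral_abs hle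
            _ ≤ ∫ s in v₀..V, (Real.exp (κ * (V - v₀)) - 1) * |S s| :=
                intervalIntegral.integral_mono_on hle hint1 hint2 hbound
    _ = (Real.exp (κ * (V - v₀)) - 1) * (|X V| + ∫ s in v₀..V, |S s|) := by
        rw [intervalIntegral.integral_const_mul]
        ring

/-! ## 2. Tame genericity = one escaping tame curve through every exceptional datum -/

section Tame

open Literature.Geometry.Lorentzian

variable {X : Type} [TopologicalSpace X] [ChartedSpace E3 X] [IsManifold (𝓡 3) ∞ X]

/-- **One escaping tame curve through `d`** for the property `P` inside the admissible class `𝓓`: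
an end `e`, a one-parameter family `F`, tame on `e` (`IsTameDataFamily`: jointly smooth, sole end,
DR rates with continuous mass, weighted-continuous at `0`), immersed at `0`, injective, `F 0 = d`,
all members admissible, all members off `0` satisfying `P`.  This is the body of
`InitialDataSet.HasTameCodimAtLeastIn` at one datum. [cite: Christodoulou1999, p. A24] -/
def EscapesAlongTameCurve (𝓓 : Set (InitialDataSet (𝓡 3) X))
    (P : InitialDataSet (𝓡 3) X → Prop) (d : InitialDataSet (𝓡 3) X) : Prop :=
  ∃ (e : AFEnd X) (F : EuclideanSpace ℝ (Fin 1) → InitialDataSet (𝓡 3) X),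
    InitialDataSet.IsTameDataFamily e 1 F ∧ InitialDataSet.IsImmersedAtZero 1 F ∧ F 0 = d ∧
      Function.Injective F ∧ (∀ c, F c ∈ 𝓓) ∧ ∀ c ≠ 0, P (F c)

/-- The Statement's tame Christodoulou genericity (codimension `1`) unfolds to: every admissible
datum failing `P` escapes along a tame curve. [cite: Christodoulou1999, p. A24] -/
theorem isTameChristodoulouGeneric_iff (𝓓 : Set (InitialDataSet (𝓡 3) X))
    (P : InitialDataSet (𝓡 3) X → Prop) :
    InitialDataSet.IsTameChristodoulouGeneric 𝓓 P 1 ↔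
      ∀ d ∈ 𝓓, ¬ P d → EscapesAlongTameCurve 𝓓 P d := by
  constructor
  · intro h d hd hP
    obtain ⟨e, F, hT, hI, h0, hinj, hD, hE⟩ := h d ⟨hd, hP⟩
    exact ⟨e, F, hT, hI, h0, hinj, hD, fun c hc => by
      by_contra hPc
      exact hE c hc ⟨hD c, hPc⟩⟩
  · intro h d hd
    obtain ⟨e, F, hT, hI, h0, hinj, hD, hP⟩ := h d hd.1 hd.2
    exact ⟨e, F, hT, hI, h0, hinj, hD, fun c hc hc' => hc'.2 (hP c hc)⟩

/-- Escape along a tame curve is monotone in the property (on the admissible class). -/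
theorem EscapesAlongTameCurve.mono {𝓓 : Set (InitialDataSet (𝓡 3) X)}
    {P Q : InitialDataSet (𝓡 3) X → Prop} {d : InitialDataSet (𝓡 3) X}
    (h : EscapesAlongTameCurve 𝓓 P d) (hPQ : ∀ D ∈ 𝓓, P D → Q D) :
    EscapesAlongTameCurve 𝓓 Q d := by
  obtain ⟨e, F, hT, hI, h0, hinj, hD, hP⟩ := h
  exact ⟨e, F, hT, hI, h0, hinj, hD, fun c hc => hPQ _ (hD c) (hP c hc)⟩

/-! ## 3. The assembly shape of the line `flat-backward-dial` (pure logic, proved)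

`B` = censorship (complete `𝓘⁺` of every MGHD), `M` = the order-2 windowed bounded-boost collar
margin of one datum (`Margin₂` of `OrderTwoAssemblyProbe.lean`, with H4/H5b), `𝒮` = the
BACKWARD-REPRESENTABLE class (developments that are the unique backward development of their own
`𝓗⁺ ∪ 𝓘⁺` data, in the class where the truncated, spin-dialled backward problem is well posed).
The four hypotheses are the four stubs of the line; the conclusion is the restated crux in the
Statement's tame genericity. -/

/-- **Dial assembly.**  If
* `hCens`  — censorship-failing admissible data escape along tame curves INTO `𝒮`
             (curve-form weak cosmic censorship with settling, backward-representable members: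
             the shared WCC-sized input of every route);
* `hPost`  — FLAT POST-COMPOSITION: any tame curve through `d` whose members off `0` lie in `𝒮`
             can be re-dialled (final spin lowered by a flat amount `η(c)`, gauge jet for
             immersion) into a tame curve whose members off `0` satisfy `B ∧ M`;
* `hRates` — ULTIMATELY-EXTREMAL RATES: a censored admissible datum failing the margin is itself
             backward-representable (`d ∈ 𝒮`; Holzegel-type a-priori-conditional decay);
* `hDial`  — THE DIAL: every admissible `d ∈ 𝒮` failing the margin escapes along a tame curve
             whose members off `0` satisfy `B ∧ M` (backward construction from `d`'s own truncated
             scattering data with `a(c) = M_f (1 - η(c))`, `η` flat);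
then `B ∧ M` is tame-Christodoulou-generic with codimension `1` in `𝓓`. -/
theorem tameGeneric_and_of_dial (𝓓 𝒮 : Set (InitialDataSet (𝓡 3) X))
    (B M : InitialDataSet (𝓡 3) X → Prop)
    (hCens : ∀ d ∈ 𝓓, ¬ B d → EscapesAlongTameCurve 𝓓 (fun D => D ∈ 𝒮) d)
    (hPost : ∀ d ∈ 𝓓, EscapesAlongTameCurve 𝓓 (fun D => D ∈ 𝒮) d →
      EscapesAlongTameCurve 𝓓 (fun D => B D ∧ M D) d)
    (hRates : ∀ d ∈ 𝓓, B d → ¬ M d → d ∈ 𝒮)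
    (hDial : ∀ d ∈ 𝓓, d ∈ 𝒮 → ¬ M d → EscapesAlongTameCurve 𝓓 (fun D => B D ∧ M D) d) :
    InitialDataSet.IsTameChristodoulouGeneric 𝓓 (fun D => B D ∧ M D) 1 := by
  rw [isTameChristodoulouGeneric_iff]
  intro d hd hBM
  by_cases hB : B d
  · have hM : ¬ M d := fun hM => hBM ⟨hB, hM⟩
    exact hDial d hd (hRates d hd hB hM) hM
  · exact hPost d hd (hCens d hd hB)

end Tame

end Summit.FinalStateConjecture.FinalStateConjecture.Cruxes.GenericCensorshipCollarMargin.FlatBackwardDial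

end
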